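import Summits.CriticalPhenomena.PercolationContinuityZ3.Theorems.SoloInformedMushroomFatFeet
import HarnessLib

/-!
# Mushroom transport IV: the `{0, ∞}` dichotomy for `E_{p_c}[|C_ℍ(0)| ; 0 ↔ ∞]` and face 17

Solo seat `solo-CriticalPhenomena-informed`, portrait item S16 / equivalent face 17 of
`paper/sharpest-statement.md` (kernel form of CLAIMS C41), part IV. Notation as in parts I–III:
`ℍ = {x | 0 ≤ x₀}`, `C_ℍ(x)` the open cluster of `x` inside `ℍ`, `L_s = {z | z₀ = s}`,
`|·| = Set.encard` in `ℝ≥0∞`, `{x ↔ ∞} = percolatesAt x`, `E[f ; A] = ∫⁻ 1_A f`.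

Summing the flat profile of part III (`lintegral_layerRatio_percolatesAt_nat`:
`E_{p_c}[|L_t ∩ C_ℍ(0)| / |L_0 ∩ C_ℍ(0)| ; 0 ↔ ∞] = θ(p_c)` for every `t ∈ ℕ`) over the layers
`ℍ = ⋃_{t ≥ 0} L_t` (`encard_openClusterIn_eq_tsum_layer`, Tonelli):
* `lintegral_encard_div_layer_percolatesAt` — `E_{p_c}[|C_ℍ(0)| / |L_0 ∩ C_ℍ(0)| ; 0 ↔ ∞] = Σ_{t ∈ ℕ} θ(p_c)`;
* since `0 ∈ L_0 ∩ C_ℍ(0)`: `lintegral_encard_percolatesAt_eq_top` — if `θ(p_c) > 0` then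
  `E_{p_c}[|C_ℍ(0)| ; 0 ↔ ∞] = ∞` although `C_ℍ(0) < ∞` a.s.; trivially `= 0` if `θ(p_c) = 0`
  (`lintegral_encard_percolatesAt_eq_zero`); so `E_{p_c}[|C_ℍ(0)| ; 0 ↔ ∞] ∈ {0, ∞}`
  (`lintegral_encard_percolatesAt_eq_zero_or_top`);
* FACE 17 (`percolationContinuity_iff_lintegral_encard_percolatesAt_lt_top`, `…_eq_zero`,
  `percolationContinuityZ3_iff_…` for `d = 3`): `θ(p_c(ℤ^d)) = 0 ↔ E_{p_c}[|C_ℍ(0)| ; 0 ↔ ∞] < ∞`.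

Any proof of `θ(p_c) = 0` on `ℤ³` is therefore exactly a proof that the (a.s. finite) critical
half-space cluster of the origin has finite mean size on the event that the origin percolates in
the full space; no intermediate value is possible. [folklore]
-/

noncomputable section

namespace Summit.CriticalPhenomena.PercolationContinuityZ3.Theorems

open MeasureTheory ProbabilityTheory Filter Topology
open Literature.Probability.Percolation Literature.Probability.LatticeModels
open scoped ENNReal

namespace Mushroom

variable {d : ℕ}

/-! ## Summing the layers: the `{0, ∞}` dichotomy and face 17 -/

/-- `|C_ℍ(0)| = Σ_{t ∈ ℕ} |L_t ∩ C_ℍ(0)|` (in `ℝ≥0∞`): the half-space cluster of the origin lies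
in `ℍ = ⋃_{t ≥ 0} L_t`. [folklore] -/
theorem encard_openClusterIn_eq_tsum_layer [NeZero d] (ω : BondConfig (Site d)) :
    (((openClusterIn (withinGraph (zdGraph d) (halfSpace d)) ω 0).encard : ℕ∞) : ℝ≥0∞) =
      ∑' t : ℕ, ((({z : Site d | z 0 = (t : ℤ)} ∩
        openClusterIn (withinGraph (zdGraph d) (halfSpace d)) ω 0).encard : ℕ∞) : ℝ≥0∞) := by
  classical
  simp only [encard_eq_tsum_indicator]
  rw [ENNReal.tsum_comm]
  refine tsum_congr fun z => ?_
  by_cases hz : z ∈ openClusterIn (withinGraph (zdGraph d) (halfSpace d)) ω 0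
  · have hz0 : 0 ≤ z 0 :=
      openClusterIn_withinGraph_subset (show (0 : Site d) ∈ halfSpace d by simp [halfSpace]) ω hz
    rw [Set.indicator_of_mem hz, tsum_eq_single (z 0).toNat]
    · rw [Set.indicator_of_mem (Set.mem_inter (by exact (Int.toNat_of_nonneg hz0).symm) hz)]
    · intro t ht
      refine Set.indicator_of_notMem (fun h => ht ?_) _
      have h1 : z 0 = (t : ℤ) := h.1
      rw [h1, Int.toNat_natCast]
  · rw [Set.indicator_of_notMem hz]
    symm
    exact ENNReal.tsum_eq_zero.2 fun t => Set.indicator_of_notMem (fun h => hz h.2) _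

/-- **Summed flat profile** (`d ≥ 2`):
`E_{p_c}[|C_ℍ(0)| / |L_0 ∩ C_ℍ(0)| ; 0 ↔ ∞] = Σ_{t ∈ ℕ} θ(p_c)` (Tonelli over the layers).
[folklore] -/
theorem lintegral_encard_div_layer_percolatesAt [NeZero d] (hd : 2 ≤ d) :
    ∫⁻ ω, (percolatesAt 0 : Set (BondConfig (Site d))).indicator (fun ω =>
      (((openClusterIn (withinGraph (zdGraph d) (halfSpace d)) ω 0).encard : ℕ∞) : ℝ≥0∞) /
      ((({z : Site d | z 0 = 0} ∩
        openClusterIn (withinGraph (zdGraph d) (halfSpace d)) ω 0).encard : ℕ∞) : ℝ≥0∞)) ω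
      ∂(bondPercolation (zdGraph d) (criticalProbI d)) =
    ∑' _ : ℕ, ENNReal.ofReal (theta (zdGraph d) 0 (criticalProbI d)) := by
  have hpt : ∀ ω, (percolatesAt 0 : Set (BondConfig (Site d))).indicator (fun ω =>
      (((openClusterIn (withinGraph (zdGraph d) (halfSpace d)) ω 0).encard : ℕ∞) : ℝ≥0∞) /
      ((({z : Site d | z 0 = 0} ∩
        openClusterIn (withinGraph (zdGraph d) (halfSpace d)) ω 0).encard : ℕ∞) : ℝ≥0∞)) ω =
      ∑' t : ℕ, (percolatesAt 0 : Set (BondConfig (Site d))).indicator (fun ω =>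
        ((({z : Site d | z 0 = (t : ℤ)} ∩
          openClusterIn (withinGraph (zdGraph d) (halfSpace d)) ω 0).encard : ℕ∞) : ℝ≥0∞) /
        ((({z : Site d | z 0 = 0} ∩
          openClusterIn (withinGraph (zdGraph d) (halfSpace d)) ω 0).encard : ℕ∞) : ℝ≥0∞)) ω := by
    intro ω
    by_cases hp : ω ∈ (percolatesAt 0 : Set (BondConfig (Site d)))
    · simp only [Set.indicator_of_mem hp, div_eq_mul_inv]
      rw [encard_openClusterIn_eq_tsum_layer, ENNReal.tsum_mul_right]
    · simp only [Set.indicator_of_notMem hp, tsum_zero]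
  calc _ = ∫⁻ ω, ∑' t : ℕ, (percolatesAt 0 : Set (BondConfig (Site d))).indicator (fun ω =>
        ((({z : Site d | z 0 = (t : ℤ)} ∩
          openClusterIn (withinGraph (zdGraph d) (halfSpace d)) ω 0).encard : ℕ∞) : ℝ≥0∞) /
        ((({z : Site d | z 0 = 0} ∩
          openClusterIn (withinGraph (zdGraph d) (halfSpace d)) ω 0).encard : ℕ∞) : ℝ≥0∞)) ω
        ∂(bondPercolation (zdGraph d) (criticalProbI d)) := lintegral_congr fun ω => hpt ω
    _ = ∑' t : ℕ, ∫⁻ ω, (percolatesAt 0 : Set (BondConfig (Site d))).indicator (fun ω =>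
        ((({z : Site d | z 0 = (t : ℤ)} ∩
          openClusterIn (withinGraph (zdGraph d) (halfSpace d)) ω 0).encard : ℕ∞) : ℝ≥0∞) /
        ((({z : Site d | z 0 = 0} ∩
          openClusterIn (withinGraph (zdGraph d) (halfSpace d)) ω 0).encard : ℕ∞) : ℝ≥0∞)) ω
        ∂(bondPercolation (zdGraph d) (criticalProbI d)) :=
        lintegral_tsum fun t => (((measurable_encard_layer (t : ℤ) 0).div
          (measurable_encard_layer 0 0)).indicator (measurableSet_percolatesAt_holds 0)).aemeasurable
    _ = _ := tsum_congr fun t => lintegral_layerRatio_percolatesAt_nat hd t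

/-- If `θ(p_c) = 0` then `E_{p_c}[|C_ℍ(0)| ; 0 ↔ ∞] = 0` (the event is null). [folklore] -/
theorem lintegral_encard_percolatesAt_eq_zero [NeZero d] (h : PercolationContinuity d) :
    ∫⁻ ω, (percolatesAt 0 : Set (BondConfig (Site d))).indicator (fun ω =>
      (((openClusterIn (withinGraph (zdGraph d) (halfSpace d)) ω 0).encard : ℕ∞) : ℝ≥0∞)) ω
      ∂(bondPercolation (zdGraph d) (criticalProbI d)) = 0 := by
  have h0 : bondPercolation (zdGraph d) (criticalProbI d) (percolatesAt 0) = 0 :=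
    (measureReal_eq_zero_iff (measure_ne_top _ _)).1 h
  rw [lintegral_indicator (measurableSet_percolatesAt_holds 0)]
  exact setLIntegral_measure_zero _ _ h0

/-- **If `θ(p_c) > 0` the feet are fat** (`d ≥ 2`): `E_{p_c}[|C_ℍ(0)| ; 0 ↔ ∞] = ∞`, although
`C_ℍ(0)` is almost surely finite — from the summed flat profile and `|L_0 ∩ C_ℍ(0)| ≥ 1`.
[folklore] -/
theorem lintegral_encard_percolatesAt_eq_top [NeZero d] (hd : 2 ≤ d)
    (h : ¬ PercolationContinuity d) :
    ∫⁻ ω, (percolatesAt 0 : Set (BondConfig (Site d))).indicator (fun ω =>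
      (((openClusterIn (withinGraph (zdGraph d) (halfSpace d)) ω 0).encard : ℕ∞) : ℝ≥0∞)) ω
      ∂(bondPercolation (zdGraph d) (criticalProbI d)) = ⊤ := by
  have hθ : ENNReal.ofReal (theta (zdGraph d) 0 (criticalProbI d)) ≠ 0 := by
    rw [ne_eq, ENNReal.ofReal_eq_zero, not_le]
    exact lt_of_le_of_ne measureReal_nonneg (Ne.symm h)
  refine eq_top_iff.2 ?_
  calc (⊤ : ℝ≥0∞) = ∑' _ : ℕ, ENNReal.ofReal (theta (zdGraph d) 0 (criticalProbI d)) :=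
        (ENNReal.tsum_const_eq_top_of_ne_zero hθ).symm
    _ = _ := (lintegral_encard_div_layer_percolatesAt hd).symm
    _ ≤ _ := lintegral_mono fun ω => Set.indicator_le_indicator ?_
  have h1 : (1 : ℝ≥0∞) ≤ ((({z : Site d | z 0 = 0} ∩
      openClusterIn (withinGraph (zdGraph d) (halfSpace d)) ω 0).encard : ℕ∞) : ℝ≥0∞) := by
    rw [← ENat.toENNReal_one, ENat.toENNReal_le, Set.one_le_encard_iff_nonempty]
    exact ⟨0, Set.mem_inter (by simp) (self_mem_openClusterIn _ _ _)⟩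
  calc _ = (((openClusterIn (withinGraph (zdGraph d) (halfSpace d)) ω 0).encard : ℕ∞) : ℝ≥0∞) *
        (((({z : Site d | z 0 = 0} ∩
          openClusterIn (withinGraph (zdGraph d) (halfSpace d)) ω 0).encard : ℕ∞) : ℝ≥0∞))⁻¹ :=
        div_eq_mul_inv _ _
    _ ≤ (((openClusterIn (withinGraph (zdGraph d) (halfSpace d)) ω 0).encard : ℕ∞) : ℝ≥0∞) * 1 :=
        mul_le_mul_right (ENNReal.inv_le_one.2 h1) _
    _ = _ := mul_one _

/-- **The `{0, ∞}` dichotomy** (`d ≥ 2`): `E_{p_c}[|C_ℍ(0)| ; 0 ↔ ∞] ∈ {0, ∞}`. [folklore] -/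
theorem lintegral_encard_percolatesAt_eq_zero_or_top [NeZero d] (hd : 2 ≤ d) :
    ∫⁻ ω, (percolatesAt 0 : Set (BondConfig (Site d))).indicator (fun ω =>
      (((openClusterIn (withinGraph (zdGraph d) (halfSpace d)) ω 0).encard : ℕ∞) : ℝ≥0∞)) ω
      ∂(bondPercolation (zdGraph d) (criticalProbI d)) = 0 ∨
    ∫⁻ ω, (percolatesAt 0 : Set (BondConfig (Site d))).indicator (fun ω =>
      (((openClusterIn (withinGraph (zdGraph d) (halfSpace d)) ω 0).encard : ℕ∞) : ℝ≥0∞)) ω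
      ∂(bondPercolation (zdGraph d) (criticalProbI d)) = ⊤ := by
  by_cases h : PercolationContinuity d
  · exact Or.inl (lintegral_encard_percolatesAt_eq_zero h)
  · exact Or.inr (lintegral_encard_percolatesAt_eq_top hd h)

/-- **Face 17: `θ(p_c) = 0` iff the feet are not fat** (`d ≥ 2`):
`θ(p_c(ℤ^d)) = 0 ↔ E_{p_c}[|C_ℍ(0)| ; 0 ↔ ∞] < ∞`, the half-space cluster `C_ℍ(0)` being almost
surely finite. [folklore] -/
theorem percolationContinuity_iff_lintegral_encard_percolatesAt_lt_top [NeZero d] (hd : 2 ≤ d) :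
    PercolationContinuity d ↔
      ∫⁻ ω, (percolatesAt 0 : Set (BondConfig (Site d))).indicator (fun ω =>
        (((openClusterIn (withinGraph (zdGraph d) (halfSpace d)) ω 0).encard : ℕ∞) : ℝ≥0∞)) ω
        ∂(bondPercolation (zdGraph d) (criticalProbI d)) < ⊤ := by
  constructor
  · intro h
    rw [lintegral_encard_percolatesAt_eq_zero h]
    exact ENNReal.zero_lt_top
  · intro h
    by_contra h'
    exact h.ne (lintegral_encard_percolatesAt_eq_top hd h')

/-- Face 17, sharp form (`d ≥ 2`): `θ(p_c(ℤ^d)) = 0 ↔ E_{p_c}[|C_ℍ(0)| ; 0 ↔ ∞] = 0`. [folklore] -/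
theorem percolationContinuity_iff_lintegral_encard_percolatesAt_eq_zero [NeZero d] (hd : 2 ≤ d) :
    PercolationContinuity d ↔
      ∫⁻ ω, (percolatesAt 0 : Set (BondConfig (Site d))).indicator (fun ω =>
        (((openClusterIn (withinGraph (zdGraph d) (halfSpace d)) ω 0).encard : ℕ∞) : ℝ≥0∞)) ω
        ∂(bondPercolation (zdGraph d) (criticalProbI d)) = 0 := by
  refine ⟨lintegral_encard_percolatesAt_eq_zero, fun h => ?_⟩
  rw [percolationContinuity_iff_lintegral_encard_percolatesAt_lt_top hd, h]
  exact ENNReal.zero_lt_top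

/-- **Face 17 on `ℤ³`**: `θ(p_c(ℤ³)) = 0 ↔ E_{p_c}[|C_ℍ(0)| ; 0 ↔ ∞] < ∞` — if `θ(p_c) > 0` the
almost surely finite critical half-space cluster of a percolating origin has infinite mean size
(indeed a flat mean profile, `lintegral_layerRatio_percolatesAt_nat`). [folklore] -/
theorem percolationContinuityZ3_iff_lintegral_encard_percolatesAt_lt_top :
    PercolationContinuityZ3 ↔
      ∫⁻ ω, (percolatesAt 0 : Set (BondConfig (Site 3))).indicator (fun ω =>
        (((openClusterIn (withinGraph (zdGraph 3) (halfSpace 3)) ω 0).encard : ℕ∞) : ℝ≥0∞)) ω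
        ∂(bondPercolation (zdGraph 3) (criticalProbI 3)) < ⊤ :=
  percolationContinuity_iff_lintegral_encard_percolatesAt_lt_top (d := 3) (by norm_num)

end Mushroom

end Summit.CriticalPhenomena.PercolationContinuityZ3.Theorems

end
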